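import Literature.AlgebraicGeometry.Motives.ZetaFunctionOrderZeroOffWeights
import HarnessLib

/-!
# The pole orders of `Z((X × ℙⁿ) ⊗ 𝔽_{q^m}, T)` at every `(q^m)^{−r}`:
# `ord_{(q^m)^{−r}} Z_m(X × ℙⁿ) = Σ_{i ≤ min(n,r), r−i ≤ dim X} dim H^{2(r−i)}(X)(r−i)_{(φ_{r−i}(Fᵐ)),1}`,
# and the explicit cell counts for `ℰ_{2l+3} × ℙⁿ` and `ℋ_{2l+3} × ℙⁿ` over every `𝔽_{q^m}`

Topic `Literature/AlgebraicGeometry/Motives`; THEOREMS ONLY (no definition, no instance, no named fact; D-0026).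
Assembles g52-#8 (`hasPoleOfOrderAt_zetaSeriesPow_tensor_projectiveSpace`: `ord_{t₀} Z_m(X × ℙⁿ) = Σ_{i≤n} ord_{(q^m)ⁱt₀} Z_m(X)`),
the tree's `hasPoleOfOrderAt_zetaSeriesPow` (`ord_{(q^m)^{−r}} Z_m(X) = dim H^{2r}(X)(r)_{(φ_r(Fᵐ)),1}`, `r ≤ d`) and
g52-#10 (order `0` at `(q^m)^{−r}`, `r > d`, and at `|t₀| > 1`) into the full Tate-type count for projective bundles,
and evaluates it E-free on the two quadrics of `ℙ^{2l+3}` (g52-#6, g52-#7).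

* §1 (`E` with the trace formula, `χ(φ) = q`, RH for `X` of dimension `d`):
  **`GaloisWeilCohomology.hasPoleOfOrderAt_zetaSeriesPow_tensor_projectiveSpace_eq_sum`**
  (`ord_{(q^m)^{−r}} Z((X × ℙⁿ) ⊗ 𝔽_{q^m}) = Σ_{i≤n, i≤r, r−i≤d} dim H^{2(r−i)}(X)(r−i)_{(φ(Fᵐ)),1}`, every `m ≥ 1`, every `r`),
  **`hasPoleOfOrderAt_zetaSeriesPow_tensor_projectiveSpace_of_pointCount_eq_sum`** (polynomial point counts:
  `= Σ_{i≤n, i≤r, r−i≤d} b_{2(r−i)}(X)`).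
* §2 (E-free, the quadrics): `hasPoleOfOrderAt_zetaSeriesPow_ellipticQuadric_of_dim_lt` ∕ `…_splitQuadric_of_dim_lt`
  (order `0` at `(q^m)^{−r}`, `r > 2l+2`), `hasPoleOfOrderAt_zetaSeriesPow_ellipticQuadric_at_pow` ∕ `…_splitQuadric_at_pow`
  (order `0` at `(q^m)ʲ`, `j ≥ 1`), **`hasPoleOfOrderAt_zetaSeriesPow_ellipticQuadric_tensor_projectiveSpace`**
  (`ord_{(q^m)^{−r}} Z_m(ℰ × ℙⁿ) = Σ_{i≤n, i≤r, r−i≤2l+2} c_{r−i}(m)`, `c_{l+1}(m) = 1 + [m even]`, `c_j = 1` otherwise),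
  **`hasPoleOfOrderAt_zetaSeriesPow_splitQuadric_tensor_projectiveSpace`** (`c_{l+1} = 2` for every `m`).

HC is not touched.

## References

* [TateWoodsHole1965] J. Tate, Algebraic cycles and poles of zeta functions (1965), §3 (poles ↔ cells for cellular
  varieties; `X × ℙⁿ`).
* [Kahn2020] B. Kahn, Zeta and L-Functions of Varieties and Motives (2020), Prop. 2.3 (4), (5); §6.14 Conj. 6.52.
* [Deligne1974] P. Deligne, La conjecture de Weil. I (1974), (1.5.4), Th. (1.6).
* [Hirschfeld1998] J. W. P. Hirschfeld, Projective Geometries over Finite Fields (1998), §5.2 Thm. 5.2.6 (ii)–(iii).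
* [Stichtenoth2009] H. Stichtenoth, Algebraic Function Fields and Codes (2009), Thm. 5.1.15 (f).
* [Gottsche1993] L. Göttsche, LNM 1572 (1993), §1.2 Remark 1.2.2.
* Tree: `Motives/ProjectiveSpaceConstantFieldExtensions` (g52-#8), `Motives/ZetaFunctionOrderZeroOffWeights` (g52-#10),
  `Motives/ZetaFunctionConstantFieldExtensionPoleOrder` (`hasPoleOfOrderAt_zetaSeriesPow`), `Motives/EllipticQuadricConstantFieldExtensions`
  (g52-#6), `Motives/SplitQuadricConstantFieldExtensions` (g52-#7), `Motives/EllipticQuadricPointCount`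
  (`hasPoleOfOrderAt_of_mul_prod_pow_eq_one`, `HasPoleOfOrderAt.of_mul_coe`).

## Provenance

Lane `lit-hodgefound` (summit `HodgeConjecture`, Track 2 foundations library, Layer B: motives ∕ varieties over finite
fields), seat `lit-hodgefound-p29` (literature-prover, generation 52, row g52-#11).
-/

universe u v

open Polynomial Finset CategoryTheory MonoidalCategory AlgebraicGeometry
open Literature.AlgebraicGeometry.Kahn2003 (HasPoleOfOrderAt hasPoleOfOrderAt_of_mul_prod_pow_eq_one)

noncomputable section

namespace Literature.AlgebraicGeometry.Motives

/-! ### §1 The general count in cohomology -/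

namespace GaloisWeilCohomology

variable {k : Type u} [Field k] [Finite k] {K : Type v} [Field K] [CharZero K]
  {χ : Field.absoluteGaloisGroup k →* Kˣ} (E : GaloisWeilCohomology k K χ)
variable {d : ℕ} {X : SchemeOver k}

/-- **`ord_{T=(q^m)^{−r}} Z((X × ℙⁿ) ⊗ 𝔽_{q^m}, T) = Σ_{i ≤ n, i ≤ r, r−i ≤ d} dim H^{2(r−i)}(X)(r−i)_{(φ_{r−i}(Fᵐ)),1}`**
for every `m ≥ 1` and every `r`: the summand `i` of the projective bundle formula `Z_m(X × ℙⁿ) = ∏_{i≤n} Z_m(X)((q^m)ⁱT)`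
contributes `ord_{(q^m)^{−(r−i)}} Z_m(X)`, which is the generalized multiplicity of `1` for `φ_{r−i}(Fᵐ)` when
`0 ≤ r−i ≤ d` and `0` otherwise (RH). Tate 1965 §3: the `r`-cycles of `X × ℙⁿ` modulo numerical equivalence are
`⊕ᵢ (r−i)`-cycles of `X`. [cite: TateWoodsHole1965, §3] [cite: Kahn2020, Prop. 2.3 (4), (5) and §6.14 Conj. 6.52]
[cite: Deligne1974, Th. (1.6)] -/
theorem hasPoleOfOrderAt_zetaSeriesPow_tensor_projectiveSpace_eq_sum (hE : E.HasLefschetzTraceFormula)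
    (hχ : ((χ (arithFrob k) : Kˣ) : K) = Nat.card k) (hX : IsSmoothProjective d X)
    (hRH : E.WeilRiemannHypothesisFor X d) (n : ℕ) {m : ℕ} (hm : 0 < m) (r : ℕ) :
    HasPoleOfOrderAt (zetaSeriesPow (X ⊗ projectiveSpace n k) m) ((((Nat.card k : ℚ) ^ m) ^ r)⁻¹)
      (∑ i ∈ Finset.range (n + 1), if i ≤ r ∧ r - i ≤ d then
        Module.finrank K (Module.End.maxGenEigenspace (E.ρTwist X (2 * (r - i)) (r - i : ℕ) (geomFrob k ^ m)) 1)
        else 0) := by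
  have hq : ((Nat.card k : ℚ) ^ m) ≠ 0 := pow_ne_zero _ (Nat.cast_ne_zero.mpr Nat.card_pos.ne')
  have h1 : (1 : ℚ) < (Nat.card k : ℚ) ^ m := by exact_mod_cast Nat.one_lt_pow hm.ne' Finite.one_lt_card
  refine hasPoleOfOrderAt_zetaSeriesPow_tensor_projectiveSpace n X hm fun i _ => ?_
  by_cases hir : i ≤ r
  · -- `i ≤ r`: the point is `(q^m)^{−(r−i)}`
    obtain ⟨j, rfl⟩ := Nat.exists_eq_add_of_le hir
    have hpt : (((Nat.card k : ℚ) ^ m) ^ i) * ((((Nat.card k : ℚ) ^ m) ^ (i + j))⁻¹) =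
        ((((Nat.card k : ℚ) ^ m) ^ j)⁻¹) := by
      rw [pow_add, mul_inv, ← mul_assoc, mul_inv_cancel₀ (pow_ne_zero _ hq), one_mul]
    rw [hpt, add_tsub_cancel_left]
    by_cases hjd : j ≤ d
    · rw [if_pos ⟨hir, hjd⟩]
      exact E.hasPoleOfOrderAt_zetaSeriesPow hE hχ hX hRH hjd hm
    · rw [if_neg (fun h => hjd h.2)]
      exact E.hasPoleOfOrderAt_zetaSeriesPow_of_dim_lt hE hχ hX hRH hm (by omega)
  · -- `i > r`: the point `(q^m)^{i−r}` lies outside the unit disc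
    rw [if_neg (fun h => hir h.1)]
    obtain ⟨j, rfl⟩ := Nat.exists_eq_add_of_lt (Nat.lt_of_not_le hir)
    have hpt : (((Nat.card k : ℚ) ^ m) ^ (r + j + 1)) * ((((Nat.card k : ℚ) ^ m) ^ r)⁻¹) =
        ((Nat.card k : ℚ) ^ m) ^ (j + 1) := by
      rw [add_assoc, pow_add, mul_right_comm, mul_inv_cancel₀ (pow_ne_zero _ hq), one_mul]
    rw [hpt]
    refine E.hasPoleOfOrderAt_zetaSeriesPow_of_one_lt_abs hE hχ hX hRH hm ?_
    rw [abs_of_pos (pow_pos (pow_pos (Nat.cast_pos.mpr Nat.card_pos) _) _)]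
    exact one_lt_pow₀ h1 (by omega)

/-- **Polynomial point counts: `ord_{(q^m)^{−r}} Z((X × ℙⁿ) ⊗ 𝔽_{q^m}) = Σ_{i ≤ n, i ≤ r, r−i ≤ d} b_{2(r−i)}(X)`**
for every `m ≥ 1` (g52-#7: `dim H^{2j}(X)(j)_{(φ_j(Fᵐ)),1} = b_{2j}(X)` under `#X(𝔽_{q^s}) = Σ c_r q^{rs}`).
[cite: TateWoodsHole1965, §3] [cite: Gottsche1993, §1.2 Remark 1.2.2] [cite: Kahn2020, §6.14 Conj. 6.52] -/
theorem hasPoleOfOrderAt_zetaSeriesPow_tensor_projectiveSpace_of_pointCount_eq_sum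
    (hE : E.HasLefschetzTraceFormula) (hχ : ((χ (arithFrob k) : Kˣ) : K) = Nat.card k)
    (hX : IsSmoothProjective d X) (hRH : E.WeilRiemannHypothesisFor X d) {c : ℕ → ℚ} {N : ℕ}
    (hc : ∀ m : ℕ, 0 < m →
      (pointCount X m : ℚ) = ∑ r ∈ Finset.range (N + 1), c r * (Nat.card k : ℚ) ^ (r * m))
    (n : ℕ) {m : ℕ} (hm : 0 < m) (r : ℕ) :
    HasPoleOfOrderAt (zetaSeriesPow (X ⊗ projectiveSpace n k) m) ((((Nat.card k : ℚ) ^ m) ^ r)⁻¹)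
      (∑ i ∈ Finset.range (n + 1), if i ≤ r ∧ r - i ≤ d then Module.finrank K (E.obj X (2 * (r - i))) else 0) := by
  have h := E.hasPoleOfOrderAt_zetaSeriesPow_tensor_projectiveSpace_eq_sum hE hχ hX hRH n hm r
  have hsum : (∑ i ∈ Finset.range (n + 1), if i ≤ r ∧ r - i ≤ d then
        Module.finrank K (Module.End.maxGenEigenspace (E.ρTwist X (2 * (r - i)) (r - i : ℕ) (geomFrob k ^ m)) 1)
        else 0) =
      ∑ i ∈ Finset.range (n + 1), if i ≤ r ∧ r - i ≤ d then Module.finrank K (E.obj X (2 * (r - i))) else 0 :=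
    Finset.sum_congr rfl fun i _ => by
      split_ifs
      · exact E.finrank_maxGenEigenspace_ρTwist_pow_of_pointCount_eq_sum hE hχ hX hRH hc (r - i) m
      · rfl
  rwa [hsum] at h

end GaloisWeilCohomology

/-! ### §2 E-free: the two quadrics of `ℙ^{2l+3}` times `ℙⁿ` -/

section EFree

open SmoothHypersurface (hypersurface)

variable {k : Type u} [Field k] [Finite k] (l : ℕ) {ε : k} (ε' : Fin (l + 2) → kˣ)

/-- `l + 1 ≤ 2l + 2 + 2` (any proof matches the tree's by proof irrelevance). [folklore] -/
private theorem leE (l : ℕ) : l + 1 ≤ 2 * l + 2 + 2 := by omega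

/-- The middle coordinate `l + 1`. [folklore] -/
private theorem ltE₁ (l : ℕ) : l + 1 < 2 * l + 2 + 2 := by omega

/-- The middle coordinate `l + 2`. [folklore] -/
private theorem ltE₂ (l : ℕ) : l + 2 < 2 * l + 2 + 2 := by omega

/-- `l + 2 ≤ 2l + 2 + 2`. [folklore] -/
private theorem leS (l : ℕ) : l + 2 ≤ 2 * l + 2 + 2 := by omega

/-- Coercion of a finite product of polynomials to power series (private plumbing). [folklore] -/
private theorem coe_finset_prod' (s : Finset ℕ) (f : ℕ → ℚ[X]) :
    ((∏ i ∈ s, f i : ℚ[X]) : PowerSeries ℚ) = ∏ i ∈ s, ((f i : ℚ[X]) : PowerSeries ℚ) := by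
  rw [← Polynomial.coeToPowerSeries.ringHom_apply, map_prod]
  simp only [Polynomial.coeToPowerSeries.ringHom_apply]

omit [Field k] [Finite k] in
/-- The product `∏_{i≤2l+2}(1 − (q^m)ⁱT)` as ONE coerced polynomial with exponents `1` and base `q^m ∈ ℕ` (private
plumbing, the shape of `hasPoleOfOrderAt_of_mul_prod_pow_eq_one`). [folklore] -/
private theorem prod_coe_eq' (l m : ℕ) :
    (∏ i ∈ Finset.range (2 * l + 3), ((1 - C (((Nat.card k : ℚ) ^ m) ^ i) * X : ℚ[X]) : PowerSeries ℚ)) =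
      ((∏ i ∈ Finset.range (2 * l + 3), (1 - C ((((Nat.card k ^ m : ℕ) : ℚ)) ^ i) * X) ^ 1 : ℚ[X]) :
        PowerSeries ℚ) := by
  rw [← Polynomial.coeToPowerSeries.ringHom_apply, map_prod]
  refine Finset.prod_congr rfl fun i _ => ?_
  rw [Polynomial.coeToPowerSeries.ringHom_apply, pow_one, Nat.cast_pow]

omit [Field k] [Finite k] in
/-- `(−q^{l+1})^m · (q^m)ʲ'`-type products are never `1` when the total `q`-exponent is positive: here
`|(−q^{l+1})^m · t| = q^{m(l+1)}·|t|` (private plumbing). [folklore] -/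
private theorem neg_pow_mul_ne_one' {m : ℕ} (hm : 0 < m) {t : ℚ} (ht : 0 < t)
    (h : (1 : ℚ) ≠ (Nat.card k : ℚ) ^ (m * (l + 1)) * t) :
    (-((Nat.card k : ℚ) ^ (l + 1))) ^ m * t ≠ 1 := by
  intro h1
  have habs := congrArg abs h1
  rw [abs_mul, abs_pow, abs_neg, abs_pow, Nat.abs_cast, abs_one, abs_of_pos ht, ← pow_mul,
    mul_comm (l + 1) m] at habs
  have _ := hm
  exact h habs.symm

/-- **No pole and no zero of `Z(ℰ ⊗ 𝔽_{q^m}, T)` at `(q^m)^{−r}` for `r > 2l+2 = dim ℰ`** (E-free, from the closed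
form of g52-#6). [cite: Hirschfeld1998, §5.2 Thm. 5.2.6 (iii)] [cite: TateWoodsHole1965, §3] -/
theorem hasPoleOfOrderAt_zetaSeriesPow_ellipticQuadric_of_dim_lt (hε : ¬IsSquare ε) {m : ℕ} (hm : 0 < m)
    {r : ℕ} (hr : 2 * l + 2 < r) :
    HasPoleOfOrderAt (zetaSeriesPow
        (hypersurface ((∑ i : Fin (l + 1), MvPolynomial.X (Fin.castLE (leE l) i) *
          MvPolynomial.X (Fin.rev (Fin.castLE (leE l) i))) + MvPolynomial.X (Fin.mk (l + 1) (ltE₁ l)) ^ 2 -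
          MvPolynomial.C ε * MvPolynomial.X (Fin.mk (l + 2) (ltE₂ l)) ^ 2 : MvPolynomial (Fin (2 * l + 2 + 2)) k)) m)
      ((((Nat.card k : ℚ) ^ m) ^ r)⁻¹) 0 := by
  have hZ := zetaSeriesPow_ellipticQuadric_mul_prod l hε hm
  have hqm : 1 < Nat.card k ^ m := Nat.one_lt_pow hm.ne' Finite.one_lt_card
  have hT : zetaSeriesPow
        (hypersurface ((∑ i : Fin (l + 1), MvPolynomial.X (Fin.castLE (leE l) i) *
          MvPolynomial.X (Fin.rev (Fin.castLE (leE l) i))) + MvPolynomial.X (Fin.mk (l + 1) (ltE₁ l)) ^ 2 -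
          MvPolynomial.C ε * MvPolynomial.X (Fin.mk (l + 2) (ltE₂ l)) ^ 2 : MvPolynomial (Fin (2 * l + 2 + 2)) k)) m *
      ((1 - C ((-((Nat.card k : ℚ) ^ (l + 1))) ^ m) * X : ℚ[X]) : PowerSeries ℚ) *
      ((∏ i ∈ Finset.range (2 * l + 3), (1 - C ((((Nat.card k ^ m : ℕ) : ℚ)) ^ i) * X) ^ 1 : ℚ[X]) :
        PowerSeries ℚ) = 1 := by
    rw [← prod_coe_eq', mul_assoc,
      mul_comm (((1 - C ((-((Nat.card k : ℚ) ^ (l + 1))) ^ m) * X : ℚ[X]) : PowerSeries ℚ)), hZ]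
  have h := hasPoleOfOrderAt_of_mul_prod_pow_eq_one (Finset.range (2 * l + 3)) (fun i => i) (fun _ => 1) hqm r hT
  have hfilter : (Finset.range (2 * l + 3)).filter (fun i => i = r) = ∅ :=
    Finset.filter_eq_empty_iff.mpr fun i hi h => by rw [Finset.mem_range] at hi; omega
  rw [hfilter, Finset.sum_empty, Nat.cast_pow] at h
  refine h.of_mul_coe ?_
  have hq0' : (0 : ℚ) < Nat.card k := Nat.cast_pos.mpr Nat.card_pos
  have hq0 : (Nat.card k : ℚ) ≠ 0 := hq0'.ne'
  rw [eval_sub, eval_one, eval_mul, eval_C, eval_X, sub_ne_zero, ne_eq, eq_comm]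
  refine neg_pow_mul_ne_one' l hm (inv_pos.mpr (pow_pos (pow_pos hq0' _) _)) ?_
  -- `q^{m(l+1)} · q^{−mr} = 1` would force `m(l+1) = mr`
  rw [← pow_mul, ne_eq, eq_comm, ← div_eq_mul_inv, div_eq_one_iff_eq (pow_ne_zero _ hq0)]
  intro h1
  have h'' : Nat.card k ^ (m * (l + 1)) = Nat.card k ^ (m * r) := by exact_mod_cast h1
  have := Nat.pow_right_injective Finite.one_lt_card h''
  have : l + 1 = r := Nat.eq_of_mul_eq_mul_left hm this
  omega

/-- **No pole and no zero of `Z(ℰ ⊗ 𝔽_{q^m}, T)` at `(q^m)ʲ`, `j ≥ 1`** (outside the unit disc; E-free).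
[cite: Hirschfeld1998, §5.2 Thm. 5.2.6 (iii)] [cite: Stichtenoth2009, Theorem 5.1.15 (e), (f)] -/
theorem hasPoleOfOrderAt_zetaSeriesPow_ellipticQuadric_at_pow (hε : ¬IsSquare ε) {m : ℕ} (hm : 0 < m)
    {j : ℕ} (hj : 0 < j) :
    HasPoleOfOrderAt (zetaSeriesPow
        (hypersurface ((∑ i : Fin (l + 1), MvPolynomial.X (Fin.castLE (leE l) i) *
          MvPolynomial.X (Fin.rev (Fin.castLE (leE l) i))) + MvPolynomial.X (Fin.mk (l + 1) (ltE₁ l)) ^ 2 -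
          MvPolynomial.C ε * MvPolynomial.X (Fin.mk (l + 2) (ltE₂ l)) ^ 2 : MvPolynomial (Fin (2 * l + 2 + 2)) k)) m)
      (((Nat.card k : ℚ) ^ m) ^ j) 0 := by
  have hZ := zetaSeriesPow_ellipticQuadric_mul_prod l hε hm
  have hqm : 1 < Nat.card k ^ m := Nat.one_lt_pow hm.ne' Finite.one_lt_card
  have h1 : (1 : ℚ) < (Nat.card k : ℚ) ^ m := by exact_mod_cast hqm
  -- the whole denominator as one polynomial `u`
  have hu : zetaSeriesPow
        (hypersurface ((∑ i : Fin (l + 1), MvPolynomial.X (Fin.castLE (leE l) i) *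
          MvPolynomial.X (Fin.rev (Fin.castLE (leE l) i))) + MvPolynomial.X (Fin.mk (l + 1) (ltE₁ l)) ^ 2 -
          MvPolynomial.C ε * MvPolynomial.X (Fin.mk (l + 2) (ltE₂ l)) ^ 2 : MvPolynomial (Fin (2 * l + 2 + 2)) k)) m *
      (((∏ i ∈ Finset.range (2 * l + 3), (1 - C (((Nat.card k : ℚ) ^ m) ^ i) * X)) *
        (1 - C ((-((Nat.card k : ℚ) ^ (l + 1))) ^ m) * X) : ℚ[X]) : PowerSeries ℚ) = 1 := by
    rw [Polynomial.coe_mul, coe_finset_prod']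
    exact hZ
  have hq0' : (0 : ℚ) < Nat.card k := Nat.cast_pos.mpr Nat.card_pos
  refine HasPoleOfOrderAt.of_mul_coe (u := (∏ i ∈ Finset.range (2 * l + 3),
      (1 - C (((Nat.card k : ℚ) ^ m) ^ i) * X)) * (1 - C ((-((Nat.card k : ℚ) ^ (l + 1))) ^ m) * X)) ?_ ?_
  · rw [eval_mul, eval_prod]
    refine mul_ne_zero (Finset.prod_ne_zero_iff.mpr fun i _ => ?_) ?_
    · rw [eval_sub, eval_one, eval_mul, eval_C, eval_X, ← pow_add, sub_ne_zero]
      exact (one_lt_pow₀ h1 (by omega)).ne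
    · rw [eval_sub, eval_one, eval_mul, eval_C, eval_X, sub_ne_zero, ne_eq, eq_comm]
      refine neg_pow_mul_ne_one' l hm (pow_pos (pow_pos hq0' _) _) ?_
      rw [← pow_mul, ← pow_add]
      have hq1 : (1 : ℚ) < (Nat.card k : ℚ) := by exact_mod_cast Finite.one_lt_card
      exact (one_lt_pow₀ hq1 (Nat.add_pos_left (Nat.mul_pos hm (Nat.succ_pos l)) _).ne').ne
  · rw [hu]
    exact HasPoleOfOrderAt.one _

/-- **No pole and no zero of `Z(ℋ ⊗ 𝔽_{q^m}, T)` at `(q^m)^{−r}` for `r > 2l+2 = dim ℋ`** (E-free, g52-#7's closed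
form). [cite: Hirschfeld1998, §5.2 Thm. 5.2.6 (ii)] [cite: TateWoodsHole1965, §3] -/
theorem hasPoleOfOrderAt_zetaSeriesPow_splitQuadric_of_dim_lt {m : ℕ} (hm : 0 < m) {r : ℕ} (hr : 2 * l + 2 < r) :
    HasPoleOfOrderAt (zetaSeriesPow
        (hypersurface (∑ i : Fin (l + 2), MvPolynomial.C (ε' i : k) * MvPolynomial.X (Fin.castLE (leS l) i) *
          MvPolynomial.X (Fin.rev (Fin.castLE (leS l) i)) : MvPolynomial (Fin (2 * l + 2 + 2)) k)) m)
      ((((Nat.card k : ℚ) ^ m) ^ r)⁻¹) 0 := by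
  have hZ := zetaSeriesPow_splitQuadric_mul_prod l ε' hm
  have hqm : 1 < Nat.card k ^ m := Nat.one_lt_pow hm.ne' Finite.one_lt_card
  have hT : zetaSeriesPow
        (hypersurface (∑ i : Fin (l + 2), MvPolynomial.C (ε' i : k) * MvPolynomial.X (Fin.castLE (leS l) i) *
          MvPolynomial.X (Fin.rev (Fin.castLE (leS l) i)) : MvPolynomial (Fin (2 * l + 2 + 2)) k)) m *
      ((1 - C (((Nat.card k : ℚ) ^ m) ^ (l + 1)) * X : ℚ[X]) : PowerSeries ℚ) *
      ((∏ i ∈ Finset.range (2 * l + 3), (1 - C ((((Nat.card k ^ m : ℕ) : ℚ)) ^ i) * X) ^ 1 : ℚ[X]) :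
        PowerSeries ℚ) = 1 := by
    rw [← prod_coe_eq', mul_assoc, mul_comm (((1 - C (((Nat.card k : ℚ) ^ m) ^ (l + 1)) * X : ℚ[X]) :
      PowerSeries ℚ)), hZ]
  have h := hasPoleOfOrderAt_of_mul_prod_pow_eq_one (Finset.range (2 * l + 3)) (fun i => i) (fun _ => 1) hqm r hT
  have hfilter : (Finset.range (2 * l + 3)).filter (fun i => i = r) = ∅ :=
    Finset.filter_eq_empty_iff.mpr fun i hi h => by rw [Finset.mem_range] at hi; omega
  rw [hfilter, Finset.sum_empty, Nat.cast_pow] at h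
  refine h.of_mul_coe ?_
  have h1 : (1 : ℚ) < (Nat.card k : ℚ) := by exact_mod_cast Finite.one_lt_card
  have hq0 : (Nat.card k : ℚ) ≠ 0 := Nat.cast_ne_zero.mpr Nat.card_pos.ne'
  rw [eval_sub, eval_one, eval_mul, eval_C, eval_X, sub_ne_zero, ← pow_mul, ← pow_mul, ← div_eq_mul_inv, ne_eq,
    eq_comm, div_eq_one_iff_eq (pow_ne_zero _ hq0)]
  intro h1'
  have h'' : Nat.card k ^ (m * (l + 1)) = Nat.card k ^ (m * r) := by exact_mod_cast h1'
  have := Nat.pow_right_injective Finite.one_lt_card h''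
  have : l + 1 = r := Nat.eq_of_mul_eq_mul_left hm this
  omega

/-- **No pole and no zero of `Z(ℋ ⊗ 𝔽_{q^m}, T)` at `(q^m)ʲ`, `j ≥ 1`.** [cite: Hirschfeld1998, §5.2 Thm. 5.2.6 (ii)]
[cite: Stichtenoth2009, Theorem 5.1.15 (e), (f)] -/
theorem hasPoleOfOrderAt_zetaSeriesPow_splitQuadric_at_pow {m : ℕ} (hm : 0 < m) {j : ℕ} (hj : 0 < j) :
    HasPoleOfOrderAt (zetaSeriesPow
        (hypersurface (∑ i : Fin (l + 2), MvPolynomial.C (ε' i : k) * MvPolynomial.X (Fin.castLE (leS l) i) *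
          MvPolynomial.X (Fin.rev (Fin.castLE (leS l) i)) : MvPolynomial (Fin (2 * l + 2 + 2)) k)) m)
      (((Nat.card k : ℚ) ^ m) ^ j) 0 := by
  have hZ := zetaSeriesPow_splitQuadric_mul_prod l ε' hm
  have hqm : 1 < Nat.card k ^ m := Nat.one_lt_pow hm.ne' Finite.one_lt_card
  have h1 : (1 : ℚ) < (Nat.card k : ℚ) ^ m := by exact_mod_cast hqm
  have hu : zetaSeriesPow
        (hypersurface (∑ i : Fin (l + 2), MvPolynomial.C (ε' i : k) * MvPolynomial.X (Fin.castLE (leS l) i) *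
          MvPolynomial.X (Fin.rev (Fin.castLE (leS l) i)) : MvPolynomial (Fin (2 * l + 2 + 2)) k)) m *
      (((∏ i ∈ Finset.range (2 * l + 3), (1 - C (((Nat.card k : ℚ) ^ m) ^ i) * X)) *
        (1 - C (((Nat.card k : ℚ) ^ m) ^ (l + 1)) * X) : ℚ[X]) : PowerSeries ℚ) = 1 := by
    rw [Polynomial.coe_mul, coe_finset_prod']
    exact hZ
  refine HasPoleOfOrderAt.of_mul_coe (u := (∏ i ∈ Finset.range (2 * l + 3),
      (1 - C (((Nat.card k : ℚ) ^ m) ^ i) * X)) * (1 - C (((Nat.card k : ℚ) ^ m) ^ (l + 1)) * X)) ?_ ?_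
  · rw [eval_mul, eval_prod]
    refine mul_ne_zero (Finset.prod_ne_zero_iff.mpr fun i _ => ?_) ?_
    · rw [eval_sub, eval_one, eval_mul, eval_C, eval_X, ← pow_add, sub_ne_zero]
      exact (one_lt_pow₀ h1 (by omega)).ne
    · rw [eval_sub, eval_one, eval_mul, eval_C, eval_X, ← pow_add, sub_ne_zero]
      exact (one_lt_pow₀ h1 (by omega)).ne
  · rw [hu]
    exact HasPoleOfOrderAt.one _

/-- **The cell count of `ℰ_{2l+3} × ℙⁿ` over `𝔽_{q^m}`: `ord_{(q^m)^{−r}} Z((ℰ × ℙⁿ) ⊗ 𝔽_{q^m}, T) =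
Σ_{i ≤ n, i ≤ r, r−i ≤ 2l+2} c_{r−i}(m)`** with `c_{l+1}(m) = 2` for `m` even, `1` for `m` odd, and `c_j = 1`
otherwise (E-free; g52-#6's pole orders of `Z_m(ℰ)` transferred by g52-#8). [cite: TateWoodsHole1965, §3]
[cite: Hirschfeld1998, §5.2 Thm. 5.2.6 (iii)] [cite: Kahn2020, Prop. 2.3 (4), (5)] -/
theorem hasPoleOfOrderAt_zetaSeriesPow_ellipticQuadric_tensor_projectiveSpace (hε : ¬IsSquare ε) (n : ℕ)
    {m : ℕ} (hm : 0 < m) (r : ℕ) :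
    HasPoleOfOrderAt (zetaSeriesPow
        ((hypersurface ((∑ i : Fin (l + 1), MvPolynomial.X (Fin.castLE (leE l) i) *
          MvPolynomial.X (Fin.rev (Fin.castLE (leE l) i))) + MvPolynomial.X (Fin.mk (l + 1) (ltE₁ l)) ^ 2 -
          MvPolynomial.C ε * MvPolynomial.X (Fin.mk (l + 2) (ltE₂ l)) ^ 2 : MvPolynomial (Fin (2 * l + 2 + 2)) k)) ⊗ projectiveSpace n k) m)
      ((((Nat.card k : ℚ) ^ m) ^ r)⁻¹)
      (∑ i ∈ Finset.range (n + 1), if i ≤ r ∧ r - i ≤ 2 * l + 2 then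
        (if r - i = l + 1 then (if Even m then 2 else 1) else 1) else 0) := by
  have hq : ((Nat.card k : ℚ) ^ m) ≠ 0 := pow_ne_zero _ (Nat.cast_ne_zero.mpr Nat.card_pos.ne')
  refine hasPoleOfOrderAt_zetaSeriesPow_tensor_projectiveSpace n _ hm fun i _ => ?_
  by_cases hir : i ≤ r
  · obtain ⟨j, rfl⟩ := Nat.exists_eq_add_of_le hir
    have hpt : (((Nat.card k : ℚ) ^ m) ^ i) * ((((Nat.card k : ℚ) ^ m) ^ (i + j))⁻¹) =
        ((((Nat.card k : ℚ) ^ m) ^ j)⁻¹) := by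
      rw [pow_add, mul_inv, ← mul_assoc, mul_inv_cancel₀ (pow_ne_zero _ hq), one_mul]
    rw [hpt, add_tsub_cancel_left]
    by_cases hjd : j ≤ 2 * l + 2
    · rw [if_pos ⟨hir, hjd⟩]
      by_cases hjm : j = l + 1
      · rw [if_pos hjm, hjm]
        exact hasPoleOfOrderAt_zetaSeriesPow_ellipticQuadric_middle l hε hm
      · rw [if_neg hjm]
        exact hasPoleOfOrderAt_zetaSeriesPow_ellipticQuadric_of_ne l hε hm hjd hjm
    · rw [if_neg (fun h => hjd h.2)]
      exact hasPoleOfOrderAt_zetaSeriesPow_ellipticQuadric_of_dim_lt l hε hm (by omega)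
  · rw [if_neg (fun h => hir h.1)]
    obtain ⟨j, rfl⟩ := Nat.exists_eq_add_of_lt (Nat.lt_of_not_le hir)
    have hpt : (((Nat.card k : ℚ) ^ m) ^ (r + j + 1)) * ((((Nat.card k : ℚ) ^ m) ^ r)⁻¹) =
        ((Nat.card k : ℚ) ^ m) ^ (j + 1) := by
      rw [add_assoc, pow_add, mul_right_comm, mul_inv_cancel₀ (pow_ne_zero _ hq), one_mul]
    rw [hpt]
    exact hasPoleOfOrderAt_zetaSeriesPow_ellipticQuadric_at_pow l hε hm (Nat.succ_pos j)

/-- **The cell count of `ℋ_{2l+3} × ℙⁿ` over `𝔽_{q^m}`: `ord_{(q^m)^{−r}} Z((ℋ × ℙⁿ) ⊗ 𝔽_{q^m}, T) =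
Σ_{i ≤ n, i ≤ r, r−i ≤ 2l+2} (1 + [r − i = l+1])`** for every `m ≥ 1` (E-free). [cite: TateWoodsHole1965, §3]
[cite: Hirschfeld1998, §5.2 Thm. 5.2.6 (ii)] [cite: Kahn2020, Prop. 2.3 (4), (5)] -/
theorem hasPoleOfOrderAt_zetaSeriesPow_splitQuadric_tensor_projectiveSpace (n : ℕ) {m : ℕ} (hm : 0 < m)
    (r : ℕ) :
    HasPoleOfOrderAt (zetaSeriesPow
        ((hypersurface (∑ i : Fin (l + 2), MvPolynomial.C (ε' i : k) * MvPolynomial.X (Fin.castLE (leS l) i) *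
          MvPolynomial.X (Fin.rev (Fin.castLE (leS l) i)) : MvPolynomial (Fin (2 * l + 2 + 2)) k)) ⊗ projectiveSpace n k) m)
      ((((Nat.card k : ℚ) ^ m) ^ r)⁻¹)
      (∑ i ∈ Finset.range (n + 1), if i ≤ r ∧ r - i ≤ 2 * l + 2 then
        (if r - i = l + 1 then 2 else 1) else 0) := by
  have hq : ((Nat.card k : ℚ) ^ m) ≠ 0 := pow_ne_zero _ (Nat.cast_ne_zero.mpr Nat.card_pos.ne')
  refine hasPoleOfOrderAt_zetaSeriesPow_tensor_projectiveSpace n _ hm fun i _ => ?_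
  by_cases hir : i ≤ r
  · obtain ⟨j, rfl⟩ := Nat.exists_eq_add_of_le hir
    have hpt : (((Nat.card k : ℚ) ^ m) ^ i) * ((((Nat.card k : ℚ) ^ m) ^ (i + j))⁻¹) =
        ((((Nat.card k : ℚ) ^ m) ^ j)⁻¹) := by
      rw [pow_add, mul_inv, ← mul_assoc, mul_inv_cancel₀ (pow_ne_zero _ hq), one_mul]
    rw [hpt, add_tsub_cancel_left]
    by_cases hjd : j ≤ 2 * l + 2
    · rw [if_pos ⟨hir, hjd⟩]
      exact hasPoleOfOrderAt_zetaSeriesPow_splitQuadric l ε' hm hjd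
    · rw [if_neg (fun h => hjd h.2)]
      exact hasPoleOfOrderAt_zetaSeriesPow_splitQuadric_of_dim_lt l ε' hm (by omega)
  · rw [if_neg (fun h => hir h.1)]
    obtain ⟨j, rfl⟩ := Nat.exists_eq_add_of_lt (Nat.lt_of_not_le hir)
    have hpt : (((Nat.card k : ℚ) ^ m) ^ (r + j + 1)) * ((((Nat.card k : ℚ) ^ m) ^ r)⁻¹) =
        ((Nat.card k : ℚ) ^ m) ^ (j + 1) := by
      rw [add_assoc, pow_add, mul_right_comm, mul_inv_cancel₀ (pow_ne_zero _ hq), one_mul]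
    rw [hpt]
    exact hasPoleOfOrderAt_zetaSeriesPow_splitQuadric_at_pow l ε' hm (Nat.succ_pos j)

end EFree

end Literature.AlgebraicGeometry.Motives

end
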